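import Summits.KontsevichZagierPeriods.KontsevichZagierPeriods.Theses.TerasomaMultiplication
import Summits.KontsevichZagierPeriods.KontsevichZagierPeriods.Theorems.CompleteModGammaSector.Negative.LoadBearing
import Summits.KontsevichZagierPeriods.KontsevichZagierPeriods.Theorems.TerasomaMultiplicationCompleteModGammaSectorStubStokesBoxAlg
import Summits.KontsevichZagierPeriods.KontsevichZagierPeriods.Theorems.TerasomaMultiplicationCompleteModGammaSectorTransportOfStokesBox
import Summits.KontsevichZagierPeriods.KontsevichZagierPeriods.Theorems.TerasomaMultiplicationCompleteModGammaSectorStubElliottSemialgebraic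
import Summits.KontsevichZagierPeriods.KontsevichZagierPeriods.Theorems.TerasomaMultiplicationCompleteModGammaSectorStubElliottCertificate
import Summits.KontsevichZagierPeriods.KontsevichZagierPeriods.Theorems.TerasomaMultiplicationCompleteModGammaSectorStubElliottPotentialT
import Summits.KontsevichZagierPeriods.KontsevichZagierPeriods.Theorems.TerasomaMultiplicationCompleteModGammaSectorStubElliottPotentialU
import Summits.KontsevichZagierPeriods.KontsevichZagierPeriods.Theorems.TerasomaMultiplicationCompleteModGammaSectorStubElliottIntegrable
import Literature.NumberTheory.Transcendental.KZProductIdeal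
import Literature.NumberTheory.Transcendental.KZCalculusProofs

/-!
# Cusp transport: the Elliott–Legendre sector of Conjecture 1 lands on the Beta 2-cube
# (`CompleteModGammaSector`, stmt-KontsevichZagierPeriods-14233, line `cusp-transport-to-the-beta-world`)

**Theorem (`elliottToCusp`, absolute, no transcendence input).** Let `0 < a < 1` and `c` be
rationals with `1 − a < c`, and let `z₁ ∈ (0,1)` be a real algebraic modulus. Write
`k(t;z) = t^{−a}(1−t)^{c+a−2}(1−zt)^{−a}` and `e(t;z) = k(t;z)(1−zt)` (Euler kernels of the
hypergeometric functions `₂F₁(a, 1−a; c; z)`-type behind Elliott's identity; for `a = ½`, `c = 1`,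
`∫₀¹ k = 2K`, `∫₀¹ e = 2E` in the modulus `z = k²`). Then in the Kontsevich–Zagier calculus of moves
(`Literature/NumberTheory/Transcendental/KZCalculus.lean`) the ELLIOTT–LEGENDRE REPRESENTATION

  `[(0,1)², e(t;z₁)k(u;1−z₁) + k(t;z₁)e(u;1−z₁) − k(t;z₁)k(u;1−z₁)]`

is `KZ.Equivalent` to the bare Beta 2-cube of its cusp fibre

  `[(0,1)², t^{−a}(1−t)^{c+a−2} · u^{−a}(1−u)^{c−1}]`   (value `B(1−a, c+a−1)·B(1−a, c)`),

and the same holds with both integrands multiplied by any real algebraic constant `α`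
(`elliottToCusp_smul`). For `a = ½`, `c = 1` this is LEGENDRE'S RELATION `EK′ + KE′ − KK′ = π/2`
at every algebraic modulus as an accessible identity (value of the cube: `B(½,½)B(½,1) = 2π`);
general `(a, c)` is Elliott's identity (Anderson–Qiu–Vamanamurthy–Vuorinen 2000, Cor. 3.13 (5)).

**Proof (four move instances, all inside the printed rules).** The family
`F(t,u,s) = k(t;s)k(u;1−s)(1 − st − (1−s)u)` equals the Elliott combination at `s = z₁` and the cusp
cube at `s = 0` POINTWISE (the logarithmic divergences of `K′`-type cancel inside the single
integrand), is continuous in `s ∈ [0, z₁]`, and its `s`-derivative on the open band is the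
divergence `∂_sF = ∂_tP + ∂_uQ` with the face-vanishing potentials `P = k_t k_u·t(1−t)u`,
`Q = −k_t k_u·tu(1−u)` (the two-term certificate, `stub_elliottCertificate`). Hence the landed engine
`CompleteModGammaSectorEngine.certificateTransport_of_stokesBoxBand` (ONE Newton–Leibniz move in
`s` over the closed band `[0, z₁]` with `F` as its own primitive, integrand additivity, two null
faces, and one box-Stokes move per potential after the transposition `xᵢ ↔ s`) fed with the
landed box-Stokes move `CompleteModGammaSectorEngine.stub_stokesBoxBand` applies; its analytic side
conditions are the five landed stubs `stub_elliottSemialgebraic` (ℚ-semialgebraicity),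
`stub_elliottCertificate`, `stub_elliottPotentialT`, `stub_elliottPotentialU` (fibre regularity and
face values of `P`, `Q`), `stub_elliottIntegrable` (the cusp estimate: `∂_tP`, `∂_uQ ∈ L¹` of the
band).

**Bookkeeping for the crux.** `closure_elliott_le_relations`: every Elliott–cusp pair difference
and each of its left multiples is a relation (`relations` is a left ideal,
`KZ.mul_mem_relations_left_holds`); hence the crux `CompleteModGammaSector` is EQUIVALENT to the
line's residual `ker eval ≤ sector ⊔ closure{Elliott–cusp generators}`
(`completeModGammaSector_iff_residualOffElliott`; the residual is Conjecture 1 off the Elliott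
sector, GPC-strength, not proved here).

References: M. Kontsevich, D. Zagier, *Periods* (2001), §1.2; G. D. Anderson, S.-L. Qiu,
M. K. Vamanamurthy, M. Vuorinen, *Generalized elliptic integrals and modular equations*, Pacific J.
Math. 192 (2000), Cor. 3.13 (5); G. E. Andrews, R. Askey, R. Roy, *Special Functions* (1999),
Thm 3.2.8 (Legendre's relation via the hypergeometric Wronskian).
-/

noncomputable section

-- `Summit.KontsevichZagierPeriods.KontsevichZagierPeriods.…` is the tree's mandated layout (single-conjunct summit).
set_option linter.dupNamespace false

namespace Summit.KontsevichZagierPeriods.KontsevichZagierPeriods.CompleteModGammaSectorCuspLine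

open MeasureTheory Set
open Literature.NumberTheory.Transcendental
open Literature.NumberTheory.Transcendental.KZ
open Summit.KontsevichZagierPeriods.KontsevichZagierPeriods.Theses.TerasomaMultiplication
  (CompleteModGammaSector)
open Summit.KontsevichZagierPeriods.CompleteModGammaSectorNegative
  (sector completeModGammaSector_iff_ker_le)
open Summit.KontsevichZagierPeriods.KontsevichZagierPeriods.CompleteModGammaSectorEngine
  (stub_stokesBoxBand certificateTransport_of_stokesBoxBand)

/-! ## Coordinates of fibre points -/

/-- Coordinates of `Fin.snoc x s : Fin 3 → ℝ`. [folklore] -/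
theorem snoc_apply_zero (x : Fin 2 → ℝ) (s : ℝ) : (Fin.snoc x s : Fin 3 → ℝ) 0 = x 0 := rfl

/-- Coordinates of `Fin.snoc x s : Fin 3 → ℝ`. [folklore] -/
theorem snoc_apply_one (x : Fin 2 → ℝ) (s : ℝ) : (Fin.snoc x s : Fin 3 → ℝ) 1 = x 1 := rfl

/-- Coordinates of `Fin.snoc x s : Fin 3 → ℝ`. [folklore] -/
theorem snoc_apply_two (x : Fin 2 → ℝ) (s : ℝ) : (Fin.snoc x s : Fin 3 → ℝ) 2 = s := rfl

/-! ## The sector theorem -/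

/-- **Cusp transport, scaled form** (`ElliottToCusp` with a real algebraic constant `α` in front
of both integrands): `[(0,1)², α·(e(t;z₁)k(u;1−z₁) + k(t;z₁)e(u;1−z₁) − k(t;z₁)k(u;1−z₁))]` is
KZ-equivalent to `[(0,1)², α·t^{−a}(1−t)^{c+a−2}u^{−a}(1−u)^{c−1}]` for rational `0 < a < 1`,
`1 − a < c` and real algebraic `z₁ ∈ (0,1)`, `α`: the engine
`certificateTransport_of_stokesBoxBand stub_stokesBoxBand` applied to the family `α·F`, potentials
`α·P`, `α·Q`, divergence `α·∂_tP + α·∂_uQ`, whose side conditions are the five stubs scaled by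
the constant. [cite: KontsevichZagier2001, §1.2] -/
theorem elliottToCusp_smul : ∀ (a c : ℚ) (z₁ α : ℝ), 0 < a → a < 1 → 1 - a < c → 0 < z₁ → z₁ < 1 → IsAlgebraic ℚ z₁ → IsAlgebraic ℚ α →
    ∀ (r ρ : IntegralRep 2), r.domain = {x | ∀ i, x i ∈ Set.Ioo (0:ℝ) 1} →
      Set.EqOn r.integrand (fun x => α * ((x 0) ^ (-(a : ℝ)) * (1 - x 0) ^ ((c : ℝ) + (a : ℝ) - 2) * (1 - z₁ * x 0) ^ (1 - (a : ℝ)) * ((x 1) ^ (-(a : ℝ)) * (1 - x 1) ^ ((c : ℝ) + (a : ℝ) - 2) * (1 - (1 - z₁) * x 1) ^ (-(a : ℝ))) + (x 0) ^ (-(a : ℝ)) * (1 - x 0) ^ ((c : ℝ) + (a : ℝ) - 2) * (1 - z₁ * x 0) ^ (-(a : ℝ)) * ((x 1) ^ (-(a : ℝ)) * (1 - x 1) ^ ((c : ℝ) + (a : ℝ) - 2) * (1 - (1 - z₁) * x 1) ^ (1 - (a : ℝ))) - (x 0) ^ (-(a : ℝ)) * (1 - x 0) ^ ((c : ℝ)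 + (a : ℝ) - 2) * (1 - z₁ * x 0) ^ (-(a : ℝ)) * ((x 1) ^ (-(a : ℝ)) * (1 - x 1) ^ ((c : ℝ) + (a : ℝ) - 2) * (1 - (1 - z₁) * x 1) ^ (-(a : ℝ))))) r.domain →
      ρ.domain = {x | ∀ i, x i ∈ Set.Ioo (0:ℝ) 1} →
      Set.EqOn ρ.integrand (fun x => α * ((x 0) ^ (-(a : ℝ)) * (1 - x 0) ^ ((c : ℝ) + (a : ℝ) - 2) * ((x 1) ^ (-(a : ℝ)) * (1 - x 1) ^ ((c : ℝ) - 1)))) ρ.domain →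
      Equivalent r ρ := by
  intro a c z₁ α ha0 ha1 hac hz0 hz1 hzalg hα r ρ hrd hri hρd hρi
  -- the family, the potentials and the divergence (unscaled)
  set F : (Fin 3 → ℝ) → ℝ := fun z => (z 0) ^ (-(a : ℝ)) * (1 - z 0) ^ ((c : ℝ) + (a : ℝ) - 2) * (1 - z 2 * z 0) ^ (-(a : ℝ)) * ((z 1) ^ (-(a : ℝ)) * (1 - z 1) ^ ((c : ℝ) + (a : ℝ) - 2) * (1 - (1 - z 2) * z 1) ^ (-(a : ℝ))) * (1 - z 2 * z 0 - (1 - z 2) * z 1) with hF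
  set P : (Fin 3 → ℝ) → ℝ := fun z => (z 0) ^ (1 - (a : ℝ)) * (1 - z 0) ^ ((c : ℝ) + (a : ℝ) - 1) * (1 - z 2 * z 0) ^ (-(a : ℝ)) * ((z 1) ^ (1 - (a : ℝ)) * (1 - z 1) ^ ((c : ℝ) + (a : ℝ) - 2) * (1 - (1 - z 2) * z 1) ^ (-(a : ℝ))) with hP
  set Q : (Fin 3 → ℝ) → ℝ := fun z => -((z 0) ^ (1 - (a : ℝ)) * (1 - z 0) ^ ((c : ℝ) + (a : ℝ) - 2) * (1 - z 2 * z 0) ^ (-(a : ℝ)) * ((z 1) ^ (1 - (a : ℝ)) * (1 - z 1) ^ ((c : ℝ) + (a : ℝ) - 1) * (1 - (1 - z 2) * z 1) ^ (-(a : ℝ)))) with hQ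
  set g₀ : (Fin 3 → ℝ) → ℝ := fun z => (z 0) ^ (-(a : ℝ)) * (1 - z 0) ^ ((c : ℝ) + (a : ℝ) - 2) * (1 - z 2 * z 0) ^ (-(a : ℝ) - 1) * ((1 - (a : ℝ)) * (1 - z 0) * (1 - z 2 * z 0) - ((c : ℝ) + (a : ℝ) - 1) * z 0 * (1 - z 2 * z 0) + (a : ℝ) * z 2 * z 0 * (1 - z 0)) * ((z 1) ^ (1 - (a : ℝ)) * (1 - z 1) ^ ((c : ℝ) + (a : ℝ) - 2) * (1 - (1 - z 2) * z 1) ^ (-(a : ℝ))) with hg₀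
  set g₁ : (Fin 3 → ℝ) → ℝ := fun z => -((z 0) ^ (1 - (a : ℝ)) * (1 - z 0) ^ ((c : ℝ) + (a : ℝ) - 2) * (1 - z 2 * z 0) ^ (-(a : ℝ)) * ((z 1) ^ (-(a : ℝ)) * (1 - z 1) ^ ((c : ℝ) + (a : ℝ) - 2) * (1 - (1 - z 2) * z 1) ^ (-(a : ℝ) - 1) * ((1 - (a : ℝ)) * (1 - z 1) * (1 - (1 - z 2) * z 1) - ((c : ℝ) + (a : ℝ) - 1) * z 1 * (1 - (1 - z 2) * z 1) + (a : ℝ) * (1 - z 2) * z 1 * (1 - z 1)))) with hg₁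
  obtain ⟨hFsa, hPsa, hQsa, hg₀sa, hg₁sa⟩ := stub_elliottSemialgebraic a c z₁ ha0 ha1 hac hz0 hz1 hzalg
  have hcert := stub_elliottCertificate a c z₁ ha0 ha1 hac hz0 hz1 hzalg
  have hPT := stub_elliottPotentialT a c z₁ ha0 ha1 hac hz0 hz1 hzalg
  have hQU := stub_elliottPotentialU a c z₁ ha0 ha1 hac hz0 hz1 hzalg
  obtain ⟨hg₀i, hg₁i⟩ := stub_elliottIntegrable a c z₁ ha0 ha1 hac hz0 hz1 hzalg
  -- scaling by the algebraic constant `α`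
  have hαF := IsSemialgebraicFunOn.mul_holds
    (isSemialgebraicFunOn_const_of_isAlgebraic (IsSemialgebraicFunOn.isSemialgebraic_holds hFsa) hα) hFsa
  have hαP := IsSemialgebraicFunOn.mul_holds
    (isSemialgebraicFunOn_const_of_isAlgebraic (IsSemialgebraicFunOn.isSemialgebraic_holds hPsa) hα) hPsa
  have hαQ := IsSemialgebraicFunOn.mul_holds
    (isSemialgebraicFunOn_const_of_isAlgebraic (IsSemialgebraicFunOn.isSemialgebraic_holds hQsa) hα) hQsa
  have hαg₀ := IsSemialgebraicFunOn.mul_holds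
    (isSemialgebraicFunOn_const_of_isAlgebraic (IsSemialgebraicFunOn.isSemialgebraic_holds hg₀sa) hα) hg₀sa
  have hαg₁ := IsSemialgebraicFunOn.mul_holds
    (isSemialgebraicFunOn_const_of_isAlgebraic (IsSemialgebraicFunOn.isSemialgebraic_holds hg₁sa) hα) hg₁sa
  -- the engine, applied from the cusp fibre `s = 0` to the fibre `s = z₁`
  have hE := certificateTransport_of_stokesBoxBand stub_stokesBoxBand 2 0 z₁ (fun z => α * F z)
    ![fun z => α * g₀ z, fun z => α * g₁ z] ![fun z => α * P z, fun z => α * Q z] ρ r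
    hz0 isAlgebraic_zero hzalg hαF
    (by
      rw [Fin.forall_fin_two]
      exact ⟨hαP, hαQ⟩)
    (by
      rw [Fin.forall_fin_two]
      exact ⟨hαg₀, hαg₁⟩)
    (by
      rw [Fin.forall_fin_two]
      exact ⟨hg₀i.const_mul α, hg₁i.const_mul α⟩)
    (by
      intro x hx
      refine ⟨continuousOn_const.mul (hcert x hx).1, fun s hs => ?_⟩
      refine (((hcert x hx).2 s hs).const_mul α).congr_deriv ?_
      simp only [Fin.sum_univ_two, Matrix.cons_val_zero, Matrix.cons_val_one]
      rw [mul_add])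
    (by
      rw [Fin.forall_fin_two]
      refine ⟨fun z hz => ?_, fun z hz => ?_⟩
      · obtain ⟨h1, h2, h3, h4⟩ := hPT z hz
        refine ⟨continuousOn_const.mul h1, ?_, ?_, fun v hv => (h4 v hv).const_mul α⟩
        · show α * P (Function.update z (Fin.castSucc (0 : Fin 2)) 0) = 0
          exact mul_eq_zero.mpr (Or.inr h2)
        · show α * P (Function.update z (Fin.castSucc (0 : Fin 2)) 1) = 0
          exact mul_eq_zero.mpr (Or.inr h3)
      · obtain ⟨h1, h2, h3, h4⟩ := hQU z hz
        refine ⟨continuousOn_const.mul h1, ?_, ?_, fun v hv => (h4 v hv).const_mul α⟩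
        · show α * Q (Function.update z (Fin.castSucc (1 : Fin 2)) 0) = 0
          exact mul_eq_zero.mpr (Or.inr h2)
        · show α * Q (Function.update z (Fin.castSucc (1 : Fin 2)) 1) = 0
          exact mul_eq_zero.mpr (Or.inr h3))
    hρd
    (by
      -- the cusp fibre `α F(x, 0)` is the scaled Beta 2-cube
      intro x hx
      rw [hρd] at hx
      have hx1 := hx 1
      have h1u : 0 < 1 - x 1 := by linarith [hx1.2]
      rw [hρi (by rw [hρd]; exact hx)]
      simp only [hF, snoc_apply_zero, snoc_apply_one, snoc_apply_two, zero_mul, sub_zero,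
        Real.one_rpow, mul_one, one_mul]
      have hsplit : (1 - x 1) ^ ((c : ℝ) - 1) =
          (1 - x 1) ^ ((c : ℝ) + (a : ℝ) - 2) * (1 - x 1) ^ (-(a : ℝ)) * (1 - x 1) := by
        rw [← Real.rpow_add h1u, ← Real.rpow_add_one h1u.ne']
        congr 1
        ring
      rw [hsplit]
      ring)
    hrd
    (by
      -- the fibre `α F(x, z₁)` is the scaled Elliott–Legendre combination
      intro x hx
      rw [hrd] at hx
      have hx0 := hx 0
      have hx1 := hx 1
      have h1t : 0 < 1 - z₁ * x 0 := by nlinarith [hx0.1, hx0.2]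
      have h1u : 0 < 1 - (1 - z₁) * x 1 := by nlinarith [hx1.1, hx1.2]
      rw [hri (by rw [hrd]; exact hx)]
      simp only [hF, snoc_apply_zero, snoc_apply_one, snoc_apply_two]
      have e1 : (1 - z₁ * x 0) ^ (1 - (a : ℝ)) = (1 - z₁ * x 0) ^ (-(a : ℝ)) * (1 - z₁ * x 0) := by
        rw [← Real.rpow_add_one h1t.ne']
        congr 1
        ring
      have e2 : (1 - (1 - z₁) * x 1) ^ (1 - (a : ℝ)) =
          (1 - (1 - z₁) * x 1) ^ (-(a : ℝ)) * (1 - (1 - z₁) * x 1) := by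
        rw [← Real.rpow_add_one h1u.ne']
        congr 1
        ring
      rw [e1, e2]
      ring)
  exact hE.symm

/-- **Cusp transport lands the Elliott–Legendre sector on the Beta 2-cube** (`ElliottToCusp`,
ABSOLUTE): for rational `0 < a < 1`, `1 − a < c` and a real algebraic modulus `z₁ ∈ (0,1)`, the
representation `[(0,1)², e(t;z₁)k(u;1−z₁) + k(t;z₁)e(u;1−z₁) − k(t;z₁)k(u;1−z₁)]`
(`k(t;z) = t^{−a}(1−t)^{c+a−2}(1−zt)^{−a}`, `e = k·(1−zt)`) is KZ-equivalent to the cusp cube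
`[(0,1)², t^{−a}(1−t)^{c+a−2}u^{−a}(1−u)^{c−1}]` — `elliottToCusp_smul` at `α = 1`. For `a = ½`,
`c = 1` this is Legendre's relation `EK′ + KE′ − KK′ = π/2` at every algebraic modulus, in Euler
form, as an accessible identity. [cite: KontsevichZagier2001, §1.2] -/
theorem elliottToCusp : ∀ (a c : ℚ) (z₁ : ℝ), 0 < a → a < 1 → 1 - a < c → 0 < z₁ → z₁ < 1 → IsAlgebraic ℚ z₁ →
    ∀ (r ρ : IntegralRep 2), r.domain = {x | ∀ i, x i ∈ Set.Ioo (0:ℝ) 1} →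
      Set.EqOn r.integrand (fun x => (x 0) ^ (-(a : ℝ)) * (1 - x 0) ^ ((c : ℝ) + (a : ℝ) - 2) * (1 - z₁ * x 0) ^ (1 - (a : ℝ)) * ((x 1) ^ (-(a : ℝ)) * (1 - x 1) ^ ((c : ℝ) + (a : ℝ) - 2) * (1 - (1 - z₁) * x 1) ^ (-(a : ℝ))) + (x 0) ^ (-(a : ℝ)) * (1 - x 0) ^ ((c : ℝ) + (a : ℝ) - 2) * (1 - z₁ * x 0) ^ (-(a : ℝ)) * ((x 1) ^ (-(a : ℝ)) * (1 - x 1) ^ ((c : ℝ) + (a : ℝ) - 2) * (1 - (1 - z₁) * x 1) ^ (1 - (a : ℝ))) - (x 0) ^ (-(a : ℝ)) * (1 - x 0) ^ ((c : ℝ) + (a : ℝ) - 2) * (1 - z₁ * x 0) ^ (-(a : ℝ)) * ((x 1) ^ (-(a : ℝ)) * (1 - x 1) ^ ((c : ℝ) + (a : ℝ) - 2) * (1 - (1 - z₁) * x 1) ^ (-(a : ℝ)))) r.domain →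
      ρ.domain = {x | ∀ i, x i ∈ Set.Ioo (0:ℝ) 1} →
      Set.EqOn ρ.integrand (fun x => (x 0) ^ (-(a : ℝ)) * (1 - x 0) ^ ((c : ℝ) + (a : ℝ) - 2) * ((x 1) ^ (-(a : ℝ)) * (1 - x 1) ^ ((c : ℝ) - 1))) ρ.domain →
      Equivalent r ρ := by
  intro a c z₁ ha0 ha1 hac hz0 hz1 hzalg r ρ hrd hri hρd hρi
  refine elliottToCusp_smul a c z₁ 1 ha0 ha1 hac hz0 hz1 hzalg isAlgebraic_one r ρ hrd
    (fun x hx => ?_) hρd (fun x hx => ?_)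
  · rw [hri hx]
    simp only [one_mul]
  · rw [hρi hx]
    simp only [one_mul]


/-- **`stub_elliottToCusp`** — the registered stub of the sibling lead seat's skeleton for the
same line (product form `k(t;z₁)k(u;1−z₁)·(1 − z₁t − (1−z₁)u)` of the Elliott–Legendre integrand,
flat form of the cusp cube): derived from `elliottToCusp` by the pointwise identity
`e(t;z) = k(t;z)(1 − zt)`. [cite: KontsevichZagier2001, §1.2] -/
theorem stub_elliottToCusp : ∀ (a c : ℚ) (z₁ : ℝ), 0 < a → a < 1 → 1 - a < c → IsAlgebraic ℚ z₁ → 0 < z₁ → z₁ < 1 → ∀ (r ρ : IntegralRep 2), r.domain = {x | ∀ i, x i ∈ Set.Ioo (0:ℝ) 1} → Set.EqOn r.integrand (fun x : Fin 2 → ℝ => ((x 0 ^ (-(a : ℝ)) * (1 - x 0) ^ ((c : ℝ) + (a : ℝ) - 2) * (1 - z₁ * x 0) ^ (-(a : ℝ)) * x 1 ^ (-(a : ℝ)) * (1 - x 1) ^ ((c : ℝ) + (a : ℝ) - 2) * (1 - (1 - z₁) * x 1) ^ (-(a : ℝ))) * (1 - z₁ * x 0 - (1 - z₁) * x 1)))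 r.domain → ρ.domain = {x | ∀ i, x i ∈ Set.Ioo (0:ℝ) 1} → Set.EqOn ρ.integrand (fun x : Fin 2 → ℝ => (x 0) ^ (-(a : ℝ)) * (1 - x 0) ^ ((c : ℝ) + (a : ℝ) - 2) * (x 1) ^ (-(a : ℝ)) * (1 - x 1) ^ ((c : ℝ) - 1)) ρ.domain → Equivalent r ρ := by
  intro a c z₁ ha0 ha1 hac hzalg hz0 hz1 r ρ hrd hri hρd hρi
  refine elliottToCusp a c z₁ ha0 ha1 hac hz0 hz1 hzalg r ρ hrd (fun x hx => ?_) hρd (fun x hx => ?_)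
  · rw [hri hx]
    rw [hrd] at hx
    have hx0 := hx 0
    have hx1 := hx 1
    have h1t : 0 < 1 - z₁ * x 0 := by nlinarith [hx0.1, hx0.2]
    have h1u : 0 < 1 - (1 - z₁) * x 1 := by nlinarith [hx1.1, hx1.2]
    have e1 : (1 - z₁ * x 0) ^ (1 - (a : ℝ)) = (1 - z₁ * x 0) ^ (-(a : ℝ)) * (1 - z₁ * x 0) := by
      rw [← Real.rpow_add_one h1t.ne']
      congr 1
      ring
    have e2 : (1 - (1 - z₁) * x 1) ^ (1 - (a : ℝ)) =
        (1 - (1 - z₁) * x 1) ^ (-(a : ℝ)) * (1 - (1 - z₁) * x 1) := by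
      rw [← Real.rpow_add_one h1u.ne']
      congr 1
      ring
    simp only [e1, e2]
    ring
  · rw [hρi hx]
    beta_reduce
    ring

/-! ## Bookkeeping for the crux: the Elliott–cusp generators are relations -/

/-- The Elliott–cusp generators (pair differences and their left multiples) are relations:
`elliottToCusp` and `relations` is a left ideal (`KZ.mul_mem_relations_left_holds`).
[cite: KontsevichZagier2001, §1.2] -/
theorem closure_elliott_le_relations :
    AddSubgroup.closure {d : FormalRep | ∃ (a c : ℚ) (z₁ : ℝ) (r ρ : IntegralRep 2), (0 < a ∧ a < 1 ∧ 1 - a < c) ∧ (0 < z₁ ∧ z₁ < 1 ∧ IsAlgebraic ℚ z₁) ∧ r.domain = {x | ∀ i, x i ∈ Set.Ioo (0:ℝ) 1} ∧ Set.EqOn r.integrand (fun x => (x 0) ^ (-(a : ℝ)) * (1 - x 0) ^ ((c : ℝ) + (a : ℝ) - 2) * (1 - z₁ * x 0) ^ (1 - (a : ℝ)) * ((x 1) ^ (-(a : ℝ)) * (1 - x 1) ^ ((c : ℝ) + (a : ℝ) - 2) * (1 - (1 - z₁) * x 1) ^ (-(a : ℝ))) + (x 0) ^ (-(a : ℝ))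 * (1 - x 0) ^ ((c : ℝ) + (a : ℝ) - 2) * (1 - z₁ * x 0) ^ (-(a : ℝ)) * ((x 1) ^ (-(a : ℝ)) * (1 - x 1) ^ ((c : ℝ) + (a : ℝ) - 2) * (1 - (1 - z₁) * x 1) ^ (1 - (a : ℝ))) - (x 0) ^ (-(a : ℝ)) * (1 - x 0) ^ ((c : ℝ) + (a : ℝ) - 2) * (1 - z₁ * x 0) ^ (-(a : ℝ)) * ((x 1) ^ (-(a : ℝ)) * (1 - x 1) ^ ((c : ℝ) + (a : ℝ) - 2) * (1 - (1 - z₁) * x 1) ^ (-(a : ℝ)))) r.domain ∧ ρ.domain = {x | ∀ i, x i ∈ Set.Ioo (0:ℝ) 1} ∧ Set.EqOn ρ.integrand (fun x => (x 0) ^ (-(a : ℝ)) * (1 - x 0) ^ ((c : ℝ) + (a : ℝ) - 2) * ((x 1) ^ (-(a : ℝ)) * (1 - x 1) ^ ((c : ℝ) - 1))) ρ.domain ∧ (d = of r - of ρ ∨ ∃ w : FormalRep, d = w * (of r - of ρ))} ≤ relations := by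
  rw [AddSubgroup.closure_le]
  rintro d ⟨a, c, z₁, r, ρ, ⟨ha0, ha1, hac⟩, ⟨hz0, hz1, hzalg⟩, hrd, hri, hρd, hρi, hd⟩
  have he : of r - of ρ ∈ relations :=
    elliottToCusp a c z₁ ha0 ha1 hac hz0 hz1 hzalg r ρ hrd hri hρd hρi
  rcases hd with rfl | ⟨w, rfl⟩
  · exact he
  · exact mul_mem_relations_left_holds _ w he

/-- **No sector lever splits the crux.** For every subgroup `S` of relations (the output of ANY
line that proves a sector of Conjecture 1 absolutely), `sector ⊔ S = sector`, so the crux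
`CompleteModGammaSector` (kernel form `ker eval ≤ sector`, `completeModGammaSector_iff_ker_le`) is
EQUIVALENT to the residual `ker eval ≤ sector ⊔ S` such a line leaves behind: the residual of a
sector lever is never weaker than the crux itself. [cite: KontsevichZagier2001, §1.2 Conjecture 1] -/
theorem completeModGammaSector_iff_residual_of_le_relations (S : AddSubgroup FormalRep)
    (hS : S ≤ relations) : CompleteModGammaSector ↔ eval.ker ≤ sector ⊔ S := by
  rw [completeModGammaSector_iff_ker_le]
  constructor
  · exact fun h => le_trans h le_sup_left
  · exact fun h => le_trans h (sup_le le_rfl (le_trans hS le_sup_left))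

/-- **The crux is equivalent to the line's residual.** Since the Elliott–cusp generators are
relations (`closure_elliott_le_relations`), `sector ⊔ closure{generators} = sector`, so
`CompleteModGammaSector` holds iff `ker eval ≤ sector ⊔ closure{Elliott–cusp generators}` — the
registered residual stub `stub_residualOffElliott` of the line (Conjecture 1 modulo Γ and modulo
the Elliott sector: GPC-strength, crux-implied, not proved here;
`completeModGammaSector_iff_residual_of_le_relations`). [cite: KontsevichZagier2001, §1.2 Conjecture 1] -/
theorem completeModGammaSector_iff_residualOffElliott :
    CompleteModGammaSector ↔ eval.ker ≤ sector ⊔ AddSubgroup.closure {d : FormalRep | ∃ (a c : ℚ) (z₁ : ℝ) (r ρ : IntegralRep 2), (0 < a ∧ a < 1 ∧ 1 - a < c) ∧ (0 < z₁ ∧ z₁ < 1 ∧ IsAlgebraic ℚ z₁) ∧ r.domain = {x | ∀ i, x i ∈ Set.Ioo (0:ℝ) 1} ∧ Set.EqOn r.integrand (fun x => (x 0) ^ (-(a : ℝ)) * (1 - x 0) ^ ((c : ℝ) + (a : ℝ) - 2) * (1 - z₁ * x 0) ^ (1 - (a : ℝ)) * ((x 1) ^ (-(a : ℝ)) * (1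 - x 1) ^ ((c : ℝ) + (a : ℝ) - 2) * (1 - (1 - z₁) * x 1) ^ (-(a : ℝ))) + (x 0) ^ (-(a : ℝ)) * (1 - x 0) ^ ((c : ℝ) + (a : ℝ) - 2) * (1 - z₁ * x 0) ^ (-(a : ℝ)) * ((x 1) ^ (-(a : ℝ)) * (1 - x 1) ^ ((c : ℝ) + (a : ℝ) - 2) * (1 - (1 - z₁) * x 1) ^ (1 - (a : ℝ))) - (x 0) ^ (-(a : ℝ)) * (1 - x 0) ^ ((c : ℝ) + (a : ℝ) - 2) * (1 - z₁ * x 0) ^ (-(a : ℝ)) * ((x 1) ^ (-(a : ℝ)) * (1 - x 1) ^ ((c : ℝ) + (a : ℝ) - 2) * (1 - (1 - z₁) * x 1) ^ (-(a : ℝ)))) r.domain ∧ ρ.domain = {x | ∀ i, x i ∈ Set.Ioo (0:ℝ) 1} ∧ Set.EqOn ρ.integrand (fun x => (x 0) ^ (-(a : ℝ)) * (1 - x 0) ^ ((c : ℝ) + (a : ℝ) - 2) * ((x 1) ^ (-(a : ℝ)) * (1 - x 1) ^ ((c : ℝ) - 1))) ρ.domain ∧ (d = of r - of ρ ∨ ∃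 w : FormalRep, d = w * (of r - of ρ))} :=
  completeModGammaSector_iff_residual_of_le_relations _ closure_elliott_le_relations

end Summit.KontsevichZagierPeriods.KontsevichZagierPeriods.CompleteModGammaSectorCuspLine
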